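import Literature.NumberTheory.GaloisRepresentations.ArtinConsistency
import Literature.NumberTheory.GaloisRepresentations.RelativeIdealNorm
import Literature.NumberTheory.GaloisRepresentations.CyclotomicFrobeniusNorm
import HarnessLib

/-!
# Functoriality of the Artin homomorphism: norms, Frobenius generation, cyclotomic rays

Topic `NumberTheory/GaloisRepresentations` (class field theory: Artin's proof of the reciprocity
law; continues `RayClassGroup.lean` (`artinHom`, `idealsPrimeTo`, `ray`), `RelativeIdealNorm.lean`
(`relIdealNorm`), `ArtinConsistency.lean`, `CyclotomicFrobenius.lean`); namespace
`Literature.NumberTheory.GaloisRepresentations`.  Theorems only, fully proved.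

Three inputs of the proof of Childress's Prop. 2.2 (`ker 𝒜 ⊆ 𝒫⁺𝒩`, Ch. 5 §2, PDF pp. 124–125),
in the tree's `artinHom` vocabulary (Artin maps valued in a commutative group through a
homomorphism `χ` of the Galois group, Frobenius data `galFrob`):

* `artinHom_relIdealNorm_eq_of_galFrob` — **the Consistency Property on ideals** ("by the
  Consistency Property `(𝔄_{E}/KE/E)|_K = (N_{E/F}𝔄_E / K/F)`"; Childress Ch. 5 §1, after Prop. 1.1:
  "Multiplicativity gives `(𝔄/K/E)|_L = (N_{E/F}𝔄 / L/F)` for any fractional ideal `𝔄 ∈ ℐ_E(𝔪)`"):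
  for `F ⊆ L ⊆ M`, `F ⊆ E ⊆ M`, `Gal(L/F)` commutative, and `𝔄` supported on primes of `E` above
  primes of `F` unramified in `L`, `A_{χ ∘ Frob_{L/F}}(N_{E/F} 𝔄) = A_{χ ∘ res ∘ Frob_{M/E}}(𝔄)`.
* `exists_mem_idealsPrimeTo_artinHom_eq` — **the Artin map is surjective on `ℐ_K(𝔫)`** for an
  abelian `N/K` ("the Artin map is surjective so some such `𝔅_E` exists"; Childress Thm. 2.1 (i)):
  every `χ(τ)`, `τ ∈ Gal(N/K)`, is `A_{χ ∘ Frob}(𝔅)` for some `𝔅` prime to `𝔫` (the Frobenii of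
  the primes outside any finite set generate, `closure_frobenius_eq_top`).
* `ray_le_ker_artinHom_of_isCyclotomicExtension` — **Artin reciprocity for `K(ζ_m)/K` in subgroup
  form**: for `𝔪 ≤ (m)`, `𝔪 ≠ 0`, the ray `P_K^𝔪` lies in the kernel of `A_{χ ∘ Frob}` for every
  homomorphism `χ` of `Gal(K(ζ_m)/K)` (the tree's `artinKillsRay_frobChar` pushed through `χ`, and
  `artinKillsRay_iff_ray_le_ker`).

## References

* N. Childress, *Class Field Theory*, Universitext, Springer 2009, Ch. 5 §1 (after Prop. 1.1,
  PDF p. 115), §2 Thm. 2.1 (i) (PDF p. 116) and proof of Prop. 2.2 (PDF pp. 124–125).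
  [Childress2009]
-/

noncomputable section

open NumberField IsDedekindDomain

open scoped nonZeroDivisors

namespace Literature.NumberTheory.GaloisRepresentations

universe u v w

/-! ### Artin homomorphisms and Artin symbols under a homomorphism -/

section Comp

variable {K : Type u} [Field K] [NumberField K] {G H : Type*} [CommGroup G] [CommGroup H]

/-- Two data agreeing on the support of `I` have the same Artin homomorphism at `I`. [folklore] -/
theorem artinHom_congr_support {f g : HeightOneSpectrum (𝓞 K) → G} {I : (FractionalIdeal (𝓞 K)⁰ K)ˣ}
    (h : ∀ v : HeightOneSpectrum (𝓞 K),
      FractionalIdeal.count K v (I : FractionalIdeal (𝓞 K)⁰ K) ≠ 0 → f v = g v) :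
    artinHom f I = artinHom g I := by
  rw [artinHom_apply, artinHom_apply]
  refine finprod_congr fun v => ?_
  by_cases hv : FractionalIdeal.count K v (I : FractionalIdeal (𝓞 K)⁰ K) = 0
  · rw [hv, zpow_zero, zpow_zero]
  · rw [h v hv]

/-- `φ(F_f(𝔞)) = F_{φ ∘ f}(𝔞)` for the tree's Artin symbol of a nonzero integral ideal. [folklore] -/
theorem map_artinSymbol (φ : G →* H) (f : HeightOneSpectrum (𝓞 K) → G) {I : Ideal (𝓞 K)}
    (hI : I ≠ ⊥) :
    φ (LFunctions.AbelianDensity.artinSymbol f I) = LFunctions.AbelianDensity.artinSymbol (φ ∘ f) I := by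
  rw [LFunctions.AbelianDensity.artinSymbol, LFunctions.AbelianDensity.artinSymbol,
    φ.map_finprod (LFunctions.AbelianDensity.mulSupport_artinSymbol_finite f hI)]
  simp only [map_pow, Function.comp_apply]

/-- `ArtinKillsRay` is preserved by homomorphisms of the value group. [folklore] -/
theorem artinKillsRay_comp {𝔪 : Ideal (𝓞 K)} {f : HeightOneSpectrum (𝓞 K) → G}
    (h : LFunctions.AbelianDensity.ArtinKillsRay 𝔪 f) (φ : G →* H) :
    LFunctions.AbelianDensity.ArtinKillsRay 𝔪 (φ ∘ f) := by
  intro b c hb hc hcop hbc hpos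
  have hb' : (Ideal.span {b} : Ideal (𝓞 K)) ≠ ⊥ := by simpa [Ideal.span_singleton_eq_bot] using hb
  have hc' : (Ideal.span {c} : Ideal (𝓞 K)) ≠ ⊥ := by simpa [Ideal.span_singleton_eq_bot] using hc
  rw [← map_artinSymbol φ f hb', ← map_artinSymbol φ f hc', h b c hb hc hcop hbc hpos]

end Comp

/-! ### The Consistency Property on ideals -/

section ConsistencyIdeals

variable {F : Type u} {L : Type v} {M : Type w} [Field F] [NumberField F] [Field L] [NumberField L]
  [Field M] [NumberField M] [Algebra F L] [Algebra F M] [Algebra L M] [IsScalarTower F L M]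
  [IsGalois F L] [IsGalois F M] (E : IntermediateField F M)

/-- **The Consistency Property on ideals** (Childress, Ch. 5 §1, after Prop. 1.1:
"`(𝔄/K/E)|_L = (N_{E/F}𝔄 / L/F)` for any fractional ideal `𝔄`"; used in the proof of Prop. 2.2 as
"`(𝔄_{E_i}/KE_i/E_i)|_K = (𝔭_i^{γ_i}𝔟_F^{-d_i} / K/F)`").  Let `F ⊆ L ⊆ M`, `F ⊆ E ⊆ M` with
`L/F`, `M/F` Galois, `Gal(L/F)` commutative, `χ : Gal(L/F) → G` a homomorphism to a commutative
group, and `𝔄` an invertible fractional ideal of `E` all of whose primes lie over primes of `F`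
unramified in `L`.  Then the Artin homomorphism of `𝔭 ↦ χ(Frob_𝔭(L/F))` at `N_{E/F} 𝔄` equals the
Artin homomorphism of `𝔓 ↦ χ((𝔓, M/E)|_L)` at `𝔄` (`artinHom_relIdealNorm`: the former is
`∏ χ(Frob_𝔭)^{f(𝔓|𝔭) ν_𝔓(𝔄)}`, and `Frob_𝔭^{f(𝔓|𝔭)} = (𝔓, M/E)|_L` by
`restrictNormalHom_galFrob_eq_pow`). [cite: Childress2009, Ch. 5 §1 Prop. 1.1 ff. (PDF p. 115)] -/
theorem artinHom_relIdealNorm_eq_of_galFrob (hcommL : ∀ a b : L ≃ₐ[F] L, Commute a b)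
    {G : Type*} [CommGroup G] (χ : (L ≃ₐ[F] L) →* G) (𝔄 : (FractionalIdeal (𝓞 E)⁰ E)ˣ)
    (h𝔄 : ∀ 𝔓 : HeightOneSpectrum (𝓞 E), FractionalIdeal.count E 𝔓 (𝔄 : FractionalIdeal (𝓞 E)⁰ E) ≠ 0 →
      Algebra.IsUnramifiedIn (𝓞 L) (𝔓.asIdeal.under (𝓞 F))) :
    haveI : NumberField E := NumberField.of_module_finite F E
    artinHom (fun v => χ (galFrob F L v)) (relIdealNorm F E 𝔄) =
      artinHom (fun 𝔓 : HeightOneSpectrum (𝓞 E) =>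
        χ (AlgEquiv.restrictNormalHom L ((galFrob E M 𝔓).restrictScalars F))) 𝔄 := by
  haveI : NumberField E := NumberField.of_module_finite F E
  rw [artinHom_relIdealNorm]
  refine artinHom_congr_support fun 𝔓 h𝔓 => ?_
  rw [← map_pow, ← restrictNormalHom_galFrob_eq_pow E hcommL (h𝔄 𝔓 h𝔓) 𝔓 rfl]

end ConsistencyIdeals

/-! ### Surjectivity of the Artin map on `ℐ_K(𝔫)` -/

section Surjective

variable {K : Type u} {N : Type v} [Field K] [NumberField K] [Field N] [NumberField N] [Algebra K N]
  [IsGalois K N]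

/-- **The Artin map of an abelian extension is surjective on the ideals prime to `𝔫`**
(Childress, Ch. 5 §2, Thm. 2.1 (i): "`𝒜 : ℐ_F(𝔪) → G` is surjective"; in the proof of Prop. 2.2:
"the Artin map is surjective so some such `𝔅_E` exists"): for `N/K` abelian, a homomorphism
`χ : Gal(N/K) → G`, a nonzero `𝔫` and `τ ∈ Gal(N/K)` there is `𝔅 ∈ ℐ_K(𝔫)` with
`A_{χ ∘ Frob}(𝔅) = χ(τ)`: the Frobenii of the primes `v ∤ 𝔫` unramified in `N` generate `Gal(N/K)`
(`closure_frobenius_eq_top`), and the Frobenius of such `v` is `galFrob K N v` (`eq_galFrob`), the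
value of `A` at the prime `v ∈ ℐ_K(𝔫)`. [cite: Childress2009, Ch. 5 §2 Thm. 2.1 (i) (PDF p. 116)] -/
theorem exists_mem_idealsPrimeTo_artinHom_eq (hcomm : ∀ a b : N ≃ₐ[K] N, Commute a b)
    {G : Type*} [CommGroup G] (χ : (N ≃ₐ[K] N) →* G) {𝔫 : Ideal (𝓞 K)} (h𝔫 : 𝔫 ≠ ⊥)
    (τ : N ≃ₐ[K] N) :
    ∃ 𝔅 ∈ idealsPrimeTo 𝔫, artinHom (fun v => χ (galFrob K N v)) 𝔅 = χ τ := by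
  -- the bad primes: divisors of `𝔫` and primes ramified in `N`
  set B : Set (HeightOneSpectrum (𝓞 K)) :=
    {v | 𝔫 ≤ v.asIdeal} ∪ {v | ¬ Algebra.IsUnramifiedIn (𝓞 N) v.asIdeal} with hB
  have hBfin : B.Finite := by
    refine Set.Finite.union ?_ (finite_setOf_not_isUnramifiedIn K N)
    refine (Ideal.finite_factors h𝔫).subset fun v hv => ?_
    exact Ideal.dvd_iff_le.mpr hv
  have hτ : τ ∈ Subgroup.closure {φ : N ≃ₐ[K] N | ∃ v : HeightOneSpectrum (𝓞 K), v ∉ B ∧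
      ∃ Q ∈ v.asIdeal.primesOver (𝓞 N), IsArithFrobAt (𝓞 K) φ Q} := by
    rw [closure_frobenius_eq_top hcomm hBfin]
    exact Subgroup.mem_top τ
  induction hτ using Subgroup.closure_induction with
  | mem φ hφ =>
    obtain ⟨v, hvB, Q, hQ, hφQ⟩ := hφ
    simp only [hB, Set.mem_union, Set.mem_setOf_eq, not_or, not_not] at hvB
    have heq : φ = galFrob K N v := eq_galFrob hcomm hvB.2 hQ hφQ
    refine ⟨primePowUnit v 1, primePowUnit_mem_idealsPrimeTo hvB.1 1, ?_⟩
    rw [artinHom_primePowUnit, pow_one, heq]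
  | one => exact ⟨1, Subgroup.one_mem _, by rw [map_one, map_one]⟩
  | mul φ ψ _ _ h1 h2 =>
    obtain ⟨𝔅₁, h𝔅₁, e₁⟩ := h1
    obtain ⟨𝔅₂, h𝔅₂, e₂⟩ := h2
    exact ⟨𝔅₁ * 𝔅₂, Subgroup.mul_mem _ h𝔅₁ h𝔅₂, by rw [map_mul, map_mul, e₁, e₂]⟩
  | inv φ _ h1 =>
    obtain ⟨𝔅, h𝔅, e⟩ := h1
    exact ⟨𝔅⁻¹, Subgroup.inv_mem _ h𝔅, by rw [map_inv, map_inv, e]⟩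

end Surjective

/-! ### Artin reciprocity for `K(ζ_m)/K` in subgroup form -/

section CyclotomicRay

variable {K : Type u} {N : Type v} [Field K] [NumberField K] [Field N] [NumberField N] [Algebra K N]
  (m : ℕ) [NeZero m] [IsCyclotomicExtension {m} K N]

/-- **The ray modulo `𝔪 ⊆ (m)` lies in the kernel of every Artin homomorphism of `K(ζ_m)/K`**
(Childress, Ch. 5 §2: "in the case where `K ⊆ F(ζ_m)` […] `𝒫⁺_{F,𝔪} ⊆ ker 𝒜`", PDF p. 117; the
tree's `artinKillsRay_frobChar` composed with `χ ∘ χ_m⁻¹` on the range of the cyclotomic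
character, and `artinKillsRay_iff_ray_le_ker`).  For every homomorphism `χ : Gal(K(ζ_m)/K) → G`
and nonzero `𝔪 ≤ (m)`: `P_K^𝔪 ≤ ker A_{χ ∘ Frob}`.
[cite: Childress2009, Ch. 5 §2, proof of Thm. 2.1 in the cyclotomic case (PDF p. 117)] -/
theorem ray_le_ker_artinHom_of_isCyclotomicExtension {G : Type*} [CommGroup G]
    (χ : haveI := isGalois_of_isCyclotomicExtension K N m; (N ≃ₐ[K] N) →* G)
    {𝔪 : Ideal (𝓞 K)} (h𝔪 : 𝔪 ≠ ⊥) (h𝔪m : 𝔪 ≤ Ideal.span {(m : 𝓞 K)}) :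
    haveI := isGalois_of_isCyclotomicExtension K N m
    ray 𝔪 ≤ (artinHom fun v => χ (galFrob K N v)).ker := by
  haveI := isGalois_of_isCyclotomicExtension K N m
  -- `χ ∘ χ_m⁻¹` on the range of the cyclotomic character
  set e : (N ≃ₐ[K] N) ≃* (cycloChar K N m).range :=
    MonoidHom.ofInjective (cycloChar_injective K N m) with hedef
  set ψ : (cycloChar K N m).range →* G := χ.comp e.symm.toMonoidHom with hψdef
  have hψ : (fun v => χ (galFrob K N v)) = ψ ∘ frobChar K N m := by
    funext v
    have h1 : frobChar K N m v = e (galFrob K N v) := Subtype.ext rfl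
    rw [Function.comp_apply, h1, hψdef, MonoidHom.comp_apply, MulEquiv.coe_toMonoidHom,
      MulEquiv.symm_apply_apply]
  rw [hψ, ← artinKillsRay_iff_ray_le_ker h𝔪]
  exact artinKillsRay_comp (artinKillsRay_frobChar K N m h𝔪m) ψ

end CyclotomicRay

end Literature.NumberTheory.GaloisRepresentations
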